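import Mathlib
import Literature.Barriers.ValiantsHypothesis.AlgebraicNaturalProofs
import Literature.Computability.AlgebraicComplexity.ApolarityAction
import Summits.ValiantsHypothesis.ValiantsHypothesis.Theorems.BarrierLeverSuccinctHittingSetsForVPStubSeparableCoeff
import Summits.ValiantsHypothesis.ValiantsHypothesis.Theorems.BarrierLeverSuccinctHittingSetsForVPStubDerivDimension
import Summits.ValiantsHypothesis.ValiantsHypothesis.Theorems.BarrierLeverSuccinctHittingSetsForVPStubRisingDiagonal
import Summits.ValiantsHypothesis.ValiantsHypothesis.Theorems.BarrierLeverSuccinctHittingSetsForVPStubPartialsIndependent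
import Summits.ValiantsHypothesis.ValiantsHypothesis.Theorems.BarrierLeverSuccinctHittingSetsForVPPartialsMaximal
import HarnessLib

/-!
# Crux `BarrierLever.SuccinctHittingSetsForVP` (stmt-ValiantsHypothesis-14610), line `registered` —
stub `stub_catalecticantMaximal`: THE CATALECTICANT (COEFFICIENT-MATRIX) RANK IS MAXIMAL ON SMALL
CIRCUITS (Sylvester's catalecticant method is not a natural proof against `VP` in regime `d = n`)

**What is proved (unconditional; evidence for the open item in the direction the crux predicts for
rank methods; it does NOT close the item).**

* `CatalecticantMaximal.exists_factorial_mem_smallCircuits` : for `n ≥ 8` the FACTORIAL polynomial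
  `f = Σ_{|m| ≤ n} (∏_i m_i!) x^m` (the degree-`≤ n` truncation of `∏_i Σ_k k! x_i^k`) lies in
  `SmallCircuits ℂ n 8` (landed `stub_separableCoeff` with `c_i(j) = j!`).
* `stub_catalecticantMaximal` : for every `k ≤ n/2` the rows `u ↦ (w ↦ coeff_{u+w} f)`, `|u| = k`,
  `|w| ≤ n - k`, of its order-`k` catalecticant (plain coefficient matrix `M_k[u, w] = coeff_{u+w} f`)
  are LINEARLY INDEPENDENT, i.e. the catalecticant has full row rank `#{u : |u| = k}`, the generic
  maximum. Hence "some maximal minor of `M_k` vanishes on all of `VP_n(n^b)`", `b ≥ 8`, is false: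
  the catalecticant rank method is useless against `VP` here by an explicit small circuit.

**Proof.** `coeff_{u+w} f = ∏_i (u_i + w_i)! = (∏_i w_i!) · ∏_i (w_i+u_i)!/w_i!`, and the second
factor is `coeff_w (x^u ⌟ g)` for the all-ones polynomial `g` (`exists_allOnes_mem_smallCircuits`,
`PartialsIndependent.coeff_apolarAction_monomial_one_eq_prod`). So the catalecticant of `f` is the
partial-derivative flattening of `g` with its columns scaled by the nonzero constants `∏_i w_i!`; a
vanishing combination of its rows gives `Σ_u a_u coeff_w (x^u ⌟ g) = 0` for `|w| ≤ n - k`, while for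
`|w| > n - k` every `coeff_w (x^u ⌟ g)` vanishes (`deg g ≤ n`), so `Σ_u a_u (x^u ⌟ g) = 0` and
`stub_partialsIndependent stub_risingDiagonal` (order-`k` partials of `g` are independent) forces
`a = 0`. Axioms: `propext`, `Classical.choice`, `Quot.sound`.

References: Sylvester 1851 / Iarrobino–Kanev §1.1 (catalecticants); [ForbesShpilkaVolk2018] §1.2
(rank methods are algebraically natural), Question 6.
-/

-- layout Summits/ValiantsHypothesis/ValiantsHypothesis forces the duplicated namespace component
set_option linter.dupNamespace false

namespace Summit.ValiantsHypothesis.ValiantsHypothesis.Theorems.BarrierLever.SuccinctHittingSetsForVP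

open Literature.Barriers.ValiantsHypothesis Literature.Computability.AlgebraicComplexity MvPolynomial

namespace CatalecticantMaximal

/-- **The factorial polynomial is a small circuit.** For `n ≥ 8` some `f ∈ SmallCircuits ℂ n 8` has
`coeff_m f = ∏_i m_i!` for every `m` of degree `≤ n`.
[cite: ForbesShpilkaVolk2018, Construction 25] -/
theorem exists_factorial_mem_smallCircuits (n : ℕ) (hn : 8 ≤ n) :
    ∃ f ∈ SmallCircuits ℂ n 8, ∀ m : Fin n →₀ ℕ, m.degree ≤ n →
      coeff m f = ∏ i, ((m i).factorial : ℂ) := by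
  obtain ⟨Λ, hΛ, hcoeff⟩ := stub_separableCoeff n hn (fun _ j => (j.factorial : ℂ))
  exact ⟨Λ, hΛ, fun m hm => hcoeff ⟨m, hm⟩⟩

/-- `(a + b)! = a! · descFactorial (a + b) b` (cast to `ℂ`). [folklore] -/
theorem cast_factorial_add (a b : ℕ) :
    ((a + b).factorial : ℂ) = (a.factorial : ℂ) * ((a + b).descFactorial b : ℂ) := by
  rw [← Nat.cast_mul, ← Nat.factorial_mul_descFactorial (Nat.le_add_left b a),
    Nat.add_sub_cancel]

/-- `∏_i (u_i + w_i)! = (∏_i w_i!) · ∏_i descFactorial (w_i + u_i) u_i` (cast to `ℂ`). [folklore] -/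
theorem prod_factorial_add_eq {n : ℕ} (u w : Fin n →₀ ℕ) :
    (∏ i, (((u + w) i).factorial : ℂ)) =
      (∏ i, ((w i).factorial : ℂ)) * ∏ i, (Nat.descFactorial (w i + u i) (u i) : ℂ) := by
  rw [← Finset.prod_mul_distrib]
  exact Finset.prod_congr rfl fun i _ => by
    rw [Finsupp.add_apply, add_comm (u i) (w i), cast_factorial_add]

/-- Coefficients of a monomial derivative `x^u ⌟ g` vanish at `x^w` once `|w + u| > deg g`.
[folklore] -/
theorem coeff_apolarAction_monomial_eq_zero {n : ℕ} {g : MvPolynomial (Fin n) ℂ}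
    (u w : Fin n →₀ ℕ) (h : g.totalDegree < (w + u).degree) :
    coeff w (apolarAction (monomial u (1 : ℂ)) g) = 0 := by
  rw [DerivDimension.coeff_apolarAction_monomial_one, coeff_eq_zero_of_totalDegree_lt h, zero_mul]

end CatalecticantMaximal

open CatalecticantMaximal PartialsIndependent in
/-- **Registered stub `stub_catalecticantMaximal`** (crux stmt-ValiantsHypothesis-14610, line
`registered`; wave 6): for `n ≥ 8` some `f ∈ SmallCircuits ℂ n 8` (the factorial polynomial) has,
for every `k ≤ n/2`, linearly independent catalecticant rows `u ↦ (w ↦ coeff_{u+w} f)`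
(`|u| = k`, `|w| ≤ n - k`): Sylvester's catalecticant rank attains its generic maximum on a small
circuit. [folklore] -/
theorem stub_catalecticantMaximal :
    ∀ n : ℕ, 8 ≤ n → ∃ f ∈ SmallCircuits ℂ n 8, ∀ k : ℕ, 2 * k ≤ n →
      LinearIndependent ℂ
        (fun u : {u : Fin n →₀ ℕ // u.degree = k} =>
          fun w : {w : Fin n →₀ ℕ // w.degree ≤ n - k} => MvPolynomial.coeff (u.1 + w.1) f) := by
  intro n hn
  obtain ⟨f, hf, hcoefF⟩ := exists_factorial_mem_smallCircuits n hn
  obtain ⟨g, hg, hcoefG⟩ := exists_allOnes_mem_smallCircuits n hn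
  refine ⟨f, hf, fun k hk => ?_⟩
  have hLI := stub_partialsIndependent stub_risingDiagonal n k g hk hcoefG
  rw [linearIndependent_iff'] at hLI ⊢
  intro s a hsum
  refine hLI s a (MvPolynomial.ext _ _ fun w => ?_)
  rw [coeff_sum, coeff_zero]
  simp_rw [coeff_smul, smul_eq_mul]
  by_cases hw : w.degree ≤ n - k
  · -- the row relation at column `w`, divided by the nonzero constant `∏_i w_i!`
    have key := congrFun hsum ⟨w, hw⟩
    rw [Finset.sum_apply, Pi.zero_apply] at key
    simp_rw [Pi.smul_apply, smul_eq_mul] at key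
    have hdeg : ∀ u : {u : Fin n →₀ ℕ // u.degree = k}, (w + u.1).degree ≤ n := by
      intro u
      rw [map_add]
      have hu := u.2
      omega
    have key' : (∏ i, ((w i).factorial : ℂ)) *
        ∑ u ∈ s, a u * coeff w (apolarAction (monomial u.1 (1 : ℂ)) g) = 0 := by
      rw [← key, Finset.mul_sum]
      refine Finset.sum_congr rfl fun u _ => ?_
      have hdeg' : (u.1 + w).degree ≤ n := by rw [add_comm]; exact hdeg u
      rw [coeff_apolarAction_monomial_one_eq_prod hcoefG u.1 w (hdeg u), hcoefF _ hdeg',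
        prod_factorial_add_eq]
      ring
    exact (mul_eq_zero.mp key').resolve_left (prod_factorial_ne_zero w)
  · -- beyond the degree bound every coefficient vanishes
    refine Finset.sum_eq_zero fun u _ => ?_
    rw [coeff_apolarAction_monomial_eq_zero u.1 w, mul_zero]
    rw [map_add]
    have hu := u.2
    have hgdeg : g.totalDegree ≤ n := hg.1
    omega

end Summit.ValiantsHypothesis.ValiantsHypothesis.Theorems.BarrierLever.SuccinctHittingSetsForVP
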